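/-
Copyright (c) 2026 the pub-hodgecm-mathlib formalisation cell (harness21).  Prover seat hodgecm-mathlib-F0P3-p02 (g18): line LH3 (closer stub `stub_N9`), organ J,
«the ONE-cut-off ADAPTER» (LH3-plan (g3) 2026-09-02T09:03:16Z BY NAME).
-/
import Literature.MeasureTheory.Group.OrbitalDescentNonneg     -- ★ (F0P3b-p01 (g15)): `exists_continuous_hasCompactSupport_integral_comp_mul_eq_one_pos` (Harish-Chandra's cut-off, positive on `C`); brings ★ `ConjugationCutoff`
import HarnessLib

/-!
# ONE Harish-Chandra cut-off for TWO compacts: `β ≥ 0`, `> 0` on `C₁ ∪ C₂`, of unit `M`-mass on `(C₁ ∪ C₂)·M`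
# (Harish-Chandra–van Dijk 1970 Part I §3, proof of Lemma 19; Rogawski 1990 §4.12 Lemma 4.12.1)

Topic `MeasureTheory/Group`; namespace `Literature.MeasureTheory.Group`.  THEOREMS ONLY (no `def`, no instance, no notation, no axiom, no named fact, no `sorry`); kernel lane
`--kind proof --supports stmt-HodgeConjecture-24833`.  Cell `pub/hodgecm-mathlib`, crux H413 (`stmt-HodgeConjecture-24833`), F0∕P3c line LH3 (closer stub `stub_N9`, organ J, residual
stub `stub_N9jumpGSide`), brick **«the ONE-cut-off ADAPTER»** (LH3-plan (g3) 2026-09-02T09:03:16Z BY NAME, seat F0P3-p02 (g18)): organ J reads the SAME wall point `γ_p` through TWO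
charts (the compact chart `S` along the normal — ★ (J-G′-BLOCK-ν) `exists_blockNormal_binders` p850667 gives ONE compact `C″_S`; the Cayley chart `insert w₀ S` along the `x`-ray — ★
(J-G′-BLOCK-β-ν) `exists_cayRay_binders` p850695 gives ONE compact `C″_♯`), and ★ D4b ED. 2 `chartOrbG_eq_integral_descended_of_cutoff` wants, PER CHART, a cut-off `β ≥ 0` of unit
`Z(γ_p)`-mass on `C″·Z(γ_p)`; the cross-chart consistency of organ J's ratio (LH3-p02 (g2) 2026-09-02T07:47:34Z) demands ONE `β`, hence ONE descended `(a′)_M^β`, for BOTH.  This file is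
the two-line adapter: Harish-Chandra's cut-off (★ `exists_continuous_hasCompactSupport_integral_comp_mul_eq_one_pos`, F0P3b-p01 (g15); ★ `…_eq_one`, F0P3a-p08 (g13)) at
`C := C₁ ∪ C₂` serves both compacts, with BOTH unit-mass binders stated separately (the `hβ1` binders of ★ p850417 ∕ ★ p850444 verbatim) and positivity on both (for (NONDEG)).

* `exists_cutoff_union` — `∃ β, Continuous β ∧ HasCompactSupport β ∧ (∀ g, 0 ≤ β g) ∧ (∀ c ∈ C₁, 0 < β c) ∧ (∀ c ∈ C₂, 0 < β c) ∧ (∀ c ∈ C₁, ∀ k₀, ∫_M β(c k₀ k) = 1) ∧ (∀ c ∈ C₂, ∀ k₀, ∫_M β(c k₀ k) = 1)`;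
* `exists_cutoff_union_point` — the same with a third, one-point compact `{x₀}` (positivity AT a prescribed point, e.g. the wall point itself).
HONEST LABEL: HC_CM is proved only modulo the 7 printed citations (2 remaining named inputs: hLiu418 = `stmt-HodgeConjecture-24832`, h413 = `stmt-HodgeConjecture-24833`) until rung 0
closes; count-neutral generic plumbing (no stub closes by this file alone).

## References
* [HarishChandra1970] Harish-Chandra (notes by G. van Dijk), *Harmonic Analysis on Reductive p-adic Groups*, LNM 162 (1970), Part I §3 (proof of Lemma 19; Lemmas 21–23).
* [Rogawski1990] J. D. Rogawski, *Automorphic Representations of Unitary Groups in Three Variables*, Ann. of Math. Stud. 123 (1990), §4.12 Lemma 4.12.1 p. 66.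
-/

set_option autoImplicit false

noncomputable section

open MeasureTheory MeasureTheory.Measure Topology Set Filter Function
open scoped Pointwise

namespace Literature.MeasureTheory.Group

section CutoffUnion

variable {G : Type*} [Group G] [TopologicalSpace G] [IsTopologicalGroup G] [LocallyCompactSpace G] [SecondCountableTopology G] [T2Space G]
  (M : Subgroup G) (hM : IsClosed (M : Set G)) [MeasurableSpace M] [BorelSpace M]
  (ρ : Measure M) [ρ.IsMulLeftInvariant] [IsFiniteMeasureOnCompacts ρ] [ρ.IsOpenPosMeasure]

include hM in
/-- **ONE CUT-OFF FOR TWO COMPACTS**: for compact `C₁, C₂ ⊆ G` there is ONE `β ∈ C_c(G)`, `β ≥ 0`, `β > 0` on `C₁` and on `C₂`, with `∫_M β(c k₀ k) dρ(k) = 1` for every `c ∈ C₁`,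
every `c ∈ C₂` and every `k₀ ∈ M` (Harish-Chandra's cut-off at `C₁ ∪ C₂`). [cite: HarishChandra1970, Part I §3 (proof of Lemma 19)] [cite: Rogawski1990, §4.12 Lemma 4.12.1 p. 66] -/
theorem exists_cutoff_union {C₁ C₂ : Set G} (hC₁ : IsCompact C₁) (hC₂ : IsCompact C₂) :
    ∃ β : G → ℝ, Continuous β ∧ HasCompactSupport β ∧ (∀ g, 0 ≤ β g) ∧ (∀ c ∈ C₁, 0 < β c) ∧ (∀ c ∈ C₂, 0 < β c) ∧
      (∀ c ∈ C₁, ∀ k₀ : M, ∫ h : M, β (c * (k₀ : G) * (h : G)) ∂ρ = 1) ∧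
      (∀ c ∈ C₂, ∀ k₀ : M, ∫ h : M, β (c * (k₀ : G) * (h : G)) ∂ρ = 1) := by
  obtain ⟨β, hβc, hβs, hβ0, hβpos, hβ1⟩ := exists_continuous_hasCompactSupport_integral_comp_mul_eq_one_pos M hM ρ (hC₁.union hC₂)
  exact ⟨β, hβc, hβs, hβ0, fun c hc => hβpos c (Or.inl hc), fun c hc => hβpos c (Or.inr hc),
    fun c hc k₀ => hβ1 c (Or.inl hc) k₀, fun c hc k₀ => hβ1 c (Or.inr hc) k₀⟩

include hM in
/-- **ONE CUT-OFF FOR TWO COMPACTS AND A POINT**: as `exists_cutoff_union`, and moreover `β x₀ > 0` with unit `M`-mass on `x₀·M` at a prescribed point `x₀` (e.g. the wall point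
itself, for (NONDEG)). [cite: HarishChandra1970, Part I §3 (proof of Lemma 19)] [cite: Rogawski1990, §4.12 Lemma 4.12.1 p. 66] -/
theorem exists_cutoff_union_point {C₁ C₂ : Set G} (hC₁ : IsCompact C₁) (hC₂ : IsCompact C₂) (x₀ : G) :
    ∃ β : G → ℝ, Continuous β ∧ HasCompactSupport β ∧ (∀ g, 0 ≤ β g) ∧ (∀ c ∈ C₁, 0 < β c) ∧ (∀ c ∈ C₂, 0 < β c) ∧ 0 < β x₀ ∧
      (∀ c ∈ C₁, ∀ k₀ : M, ∫ h : M, β (c * (k₀ : G) * (h : G)) ∂ρ = 1) ∧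
      (∀ c ∈ C₂, ∀ k₀ : M, ∫ h : M, β (c * (k₀ : G) * (h : G)) ∂ρ = 1) ∧
      (∀ k₀ : M, ∫ h : M, β (x₀ * (k₀ : G) * (h : G)) ∂ρ = 1) := by
  obtain ⟨β, hβc, hβs, hβ0, hβpos, hβ1⟩ :=
    exists_continuous_hasCompactSupport_integral_comp_mul_eq_one_pos M hM ρ ((hC₁.union hC₂).union (isCompact_singleton (x := x₀)))
  exact ⟨β, hβc, hβs, hβ0, fun c hc => hβpos c (Or.inl (Or.inl hc)), fun c hc => hβpos c (Or.inl (Or.inr hc)), hβpos x₀ (Or.inr (Set.mem_singleton x₀)),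
    fun c hc k₀ => hβ1 c (Or.inl (Or.inl hc)) k₀, fun c hc k₀ => hβ1 c (Or.inl (Or.inr hc)) k₀, fun k₀ => hβ1 x₀ (Or.inr (Set.mem_singleton x₀)) k₀⟩

end CutoffUnion

end Literature.MeasureTheory.Group

end
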